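import Literature.NumberTheory.Sieve.SieveFunctions
import Literature.NumberTheory.Sieve.SieveFrameworkFundamentalLemma
import HarnessLib

/-!
# Rosser's sieve: the main-term estimate behind Iwaniec's Theorem 1

Topic `Literature/NumberTheory/Sieve`; companion of `SieveFunctions.lean` (Iwaniec's `β`-sieve
functions `F_κ, f_κ`, Theorem 1 of Iwaniec, *Rosser's sieve*, Acta Arith. 36 (1980) in the printed
`y`-form: the named facts `Iwaniec1980_thm1_lower`, `Iwaniec1980_thm1_upper`) and of
`SieveFrameworkFundamentalLemma.lean` (Rosser's truncation sets `BetaSieve.pred par β D`, their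
indicators `BetaSieve.ind`, the sieve inequalities `BetaSieve.lower_sieve` / `upper_sieve` and their
summed forms `SieveSequence.lowerSum_le_sifted` / `sifted_le_upperSum`, all proved).

Iwaniec proves Theorem 1 in two steps (p. 202: "Theorem 1 follows from (3.4), (3.5), (3.7), (4.1),
(4.2), (9.1), (9.2), (6.5) and (7.7)"):

* the combinatorial step (§3): for Rosser's weights `λ^±_d = μ(d) χ^±(d)` of level `y` and
  parameter `β` ((3.6): `χ^±(d) = 0` iff some `d_m = p₁ ⋯ p_m`, `m` odd for `+` / even for `−`,
  has `d_m p_m^β ≥ y`), `S(𝒜, z) ≤ X S⁺ + R⁺`, `S(𝒜, z) ≥ X S⁻ − R⁻` ((3.4)–(3.5)) with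
  `S^± = ∑_{d ∣ P(z)} μ(d) χ^±(d) ω(d)/d` and `R^± ≤ ∑_{d < y, d ∣ P(z)} |R(𝒜, d)|` ((3.7));
  this step is PROVED in the tree (`BetaSieve.pred par β y` is exactly Rosser's set (3.6), with
  `par = 1` for `+`, `par = 0` for `−`; `SieveSequence.sifted_le_upperSum`, `lowerSum_le_sifted`;
  the level property `BetaSieve.lt_level_of_pred_of_one_le` below);
* the analytic step (§§4–9): with `β = β_κ` and `F, f` Iwaniec's functions, under `Ω(κ, L)`,
  `S⁻ > V(z) {f(s) − e^{√K} Q(s) (log y)^{−1/3}}` for `s = log y / log z ≥ β` and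
  `S⁺ < V(z) {F(s) + e^{√K} Q(s) (log y)^{−1/3}}` for `s ≥ β − 1` (identities (4.1)–(4.2),
  Lemma 20 — whose ranges are `s ≥ β − (1 ± 1)/2`, as are those of `T^±_R(s)` in (7.1)–(7.2) —
  and (9.1)–(9.2), together with (6.5) (the majorants `Q^±`), (7.7) (Lemma 18 on `T^±`) and the
  definitions `F(s) = 1 + s^{−κ} T⁺(s)`, `f(s) = 1 − s^{−κ} T⁻(s)` on p. 202).

This file vendors the analytic step as the named facts `Iwaniec1980_mainTerm_lower`,
`Iwaniec1980_mainTerm_upper` (with the `s`-dependence `e^{√K} Q(s)` of the error weakened to a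
constant `C(κ, L)`, exactly as in `Iwaniec1980_thm1_lower/upper`) and PROVES Theorem 1 from them:
`Iwaniec1980_thm1_lower_of_mainTerm`, `Iwaniec1980_thm1_upper_of_mainTerm`. In the lower bound the
range `1 ≤ s < β` is trivial (`f(s) = 0`, `S(𝒜, z) ≥ 0`); in the upper bound the range
`1 ≤ s < β − 1` is reduced to `s = β + 1` (`χ⁺(d) = 1` forces all prime factors of `d` below
`y^{1/(β+1)}`, so `S⁺(y, z) = S⁺(y, y^{1/(β+1)})`; then `V(y^{1/(β+1)}) ≤ ((β+1)/s)^κ (1 + O(1/log y)) V(z)`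
by `Ω(κ, L)` and `s^κ F(s) = (β + 1)^κ F(β + 1)` for `s ≤ β + 1`, cf. p. 202).

## Contents

* `BetaSieve.mainSum par g β D P = ∑_{d ∣ P} μ(d) χ^{par}(d) g(d)` (Iwaniec's `S^±`, Greaves' `V^±`);
* `BetaSieve.lt_level_of_pred_of_one_le` (level `< D` for `β ≥ 1`, `z ≤ D`; Iwaniec (3.7)),
  `BetaSieve.rpow_lt_of_pred_one` and `BetaSieve.mainSum_one_eq_of_level_le` (support of `χ⁺`:
  `S⁺(D, z) = S⁺(D, z')` for `D^{1/(β+1)} ≤ z' ≤ z`);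
* `HasIwaniecDimension.vprod_le` (`V(w) ≤ (log z / log w)^κ (1 + L / log w) V(z)`), `vprod_pos`,
  `inv_vprod_le`;
* the named facts `Iwaniec1980_mainTerm_lower`, `Iwaniec1980_mainTerm_upper`;
* `SieveSequence.indSum_congrSum_eq`, `SieveSequence.abs_sum_ind_remainder_le` (Iwaniec (3.4)–(3.5),
  (3.7) for a sifted sequence);
* `upperMainTermConst`, `mainSum_one_le_of_mainTerm_upper` (the upper main sum for all `1 ≤ s`);
* the proved reductions `Iwaniec1980_thm1_lower_of_mainTerm`, `Iwaniec1980_thm1_upper_of_mainTerm`,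
  `SieveSequence.Iwaniec1980_lower_of_mainTerm`, `SieveSequence.Iwaniec1980_upper_of_mainTerm`, and
  `Iwaniec1980_thm1_upper.exists_isGreatestBetaSieveData` (twin of the lower-bound lemma in
  `SieveFunctions.lean`).

## References

* H. Iwaniec, *Rosser's sieve*, Acta Arith. 36 (1980), 171–202: §3 (Lemma 1, (3.1)–(3.7)), §4
  ((4.1)–(4.6)), §8 (Lemma 20), §9 (pp. 201–202). [IwaniecActaArith1980]
* G. Greaves, *Sieves in Number Theory*, Springer (2001), §3.1.2 (Lemma 1), §3.3.1 ((1.1)), §4.4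
  (Proposition 1, Theorems 1–2: the analogous main-term bounds for a COMPOSITE of Rosser's sieve
  with a preliminary sieve, error `e^{√L} ψ(s) (log D)^{Δ−1}`). [Greaves2001]
-/

open Finset Filter Asymptotics
open scoped ArithmeticFunction.Moebius ArithmeticFunction.omega

noncomputable section

namespace Literature.NumberTheory.Sieve

namespace BetaSieve

variable {par : ℕ} {β D : ℝ}

/-! ### The main sums `S^±` and the level property for `β ≥ 1` -/

/-- `BetaSieve.mainSum par g β D P = ∑_{d ∣ P} μ(d) χ^{par}(d) g(d)`, the main term of the
`β`-sieve of parity `par` (`1`: upper, `0`: lower), parameter `β` and level `D` over the sifting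
range `P` (Iwaniec 1980, p. 179: `S^±`; Greaves, *Sieves in Number Theory*, Lemma 3.1.3: `V^±(P)`).
[folklore] -/
def mainSum (par : ℕ) (g : ArithmeticFunction ℝ) (β D : ℝ) (P : ℕ) : ℝ :=
  ∑ d ∈ P.divisors, (μ d : ℝ) * ind par β D d * g d

/-- Unfolding lemma for `mainSum`. [folklore] -/
theorem mainSum_def (par : ℕ) (g : ArithmeticFunction ℝ) (β D : ℝ) (P : ℕ) :
    mainSum par g β D P = ∑ d ∈ P.divisors, (μ d : ℝ) * ind par β D d * g d :=
  rfl

/-- With the trivial sifting range `P = 1`, `S^± = 1` (only `d = 1`, `χ(1) = 1`, `g(1) = 1`).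
[folklore] -/
theorem mainSum_one {g : ArithmeticFunction ℝ} (hg : g.IsMultiplicative) (par : ℕ) (β D : ℝ) :
    mainSum par g β D 1 = 1 := by
  simp [mainSum, ind_one, hg.map_one]

/-- **Level of Rosser's weights for `β ≥ 1`** (Iwaniec 1980, (3.7): `ρ^±_d = 0` for `d ≥ y`; Greaves
§3.3.1: "provided `p₁ ≤ D`"): if `t` is squarefree with all prime factors `< z`, `z ≤ D`, `1 ≤ β`
and `χ^{par}(t) = 1`, then `t < D`. (For `β > 1` and `z^β ≤ D` this is
`BetaSieve.lt_level_of_pred`; here `β = 1` and `z ≤ D < z^β` are allowed.) [folklore] -/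
theorem lt_level_of_pred_of_one_le (hβ : 1 ≤ β) (hD1 : 1 < D) {z : ℝ} (hzD : z ≤ D) {t : ℕ}
    (ht : Squarefree t) (hpz : ∀ p ∈ t.primeFactors, (p : ℝ) < z) (h : pred par β D t) :
    (t : ℝ) < D := by
  have ht0 : t ≠ 0 := ht.ne_zero
  by_cases h1 : t = 1
  · subst h1; push_cast; exact hD1
  have h1t : 1 < t := lt_of_le_of_ne (Nat.one_le_iff_ne_zero.mpr ht0) (Ne.symm h1)
  have hp := Nat.minFac_prime h1
  have hq2 : (2 : ℝ) ≤ t.minFac := by exact_mod_cast hp.two_le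
  have hqz : (t.minFac : ℝ) < z := hpz _ (Nat.mem_primeFactors.mpr ⟨hp, Nat.minFac_dvd t, ht0⟩)
  rw [pred_iff h1t] at h
  obtain ⟨h', hc⟩ := h
  have hD0 : 0 < D := by linarith
  by_cases hpar : t.primeFactors.card % 2 = par % 2
  · -- the condition holds at the top index: `t q^β < D` with `q^β ≥ 1`
    have hlt := hc hpar
    have hq1 : (1 : ℝ) ≤ (t.minFac : ℝ) ^ β := Real.one_le_rpow (by linarith) (by linarith)
    have ht0' : (0 : ℝ) ≤ t := Nat.cast_nonneg t
    nlinarith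
  · by_cases h1' : t / t.minFac = 1
    · -- `t = q` is prime, `< z ≤ D`
      have : t = t.minFac := by
        have := Nat.div_mul_cancel (Nat.minFac_dvd t)
        rw [h1', one_mul] at this
        exact this.symm
      rw [this]
      linarith
    · -- the condition holds for `t' = t / q` at index `ν(t) − 1`: `t' q'^β < D` with `q < q'`
      have ht' : Squarefree (t / t.minFac) :=
        ht.squarefree_of_dvd (Nat.div_dvd_of_dvd (Nat.minFac_dvd t))
      have ht'0 : t / t.minFac ≠ 0 := ht'.ne_zero
      have h1t' : 1 < t / t.minFac :=
        lt_of_le_of_ne (Nat.one_le_iff_ne_zero.mpr ht'0) (Ne.symm h1')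
      have hp' := Nat.minFac_prime h1'
      rw [pred_iff h1t'] at h'
      obtain ⟨-, hc'⟩ := h'
      have hcard : t.primeFactors.card = (t / t.minFac).primeFactors.card + 1 := by
        conv_lhs => rw [← div_minFac_mul (A := t)]
        exact card_primeFactors_mul_prime hp ht'0 (not_minFac_dvd_div ht h1)
      have hpar' : (t / t.minFac).primeFactors.card % 2 = par % 2 := by omega
      have h2 := hc' hpar'
      have hqq : (t.minFac : ℝ) < (t / t.minFac).minFac := by
        exact_mod_cast minFac_lt_of_mem_primeFactors_div ht h1
          (Nat.mem_primeFactors.mpr ⟨hp', Nat.minFac_dvd _, ht'0⟩)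
      have hq'β : ((t / t.minFac).minFac : ℝ) ≤ ((t / t.minFac).minFac : ℝ) ^ β := by
        have := Real.rpow_le_rpow_of_exponent_le (x := ((t / t.minFac).minFac : ℝ))
          (by linarith) hβ
        rwa [Real.rpow_one] at this
      have ht'pos : (0 : ℝ) < (t / t.minFac : ℕ) := by exact_mod_cast Nat.pos_of_ne_zero ht'0
      have hteq : (t : ℝ) = (t / t.minFac : ℕ) * (t.minFac : ℝ) := by
        conv_lhs => rw [← div_minFac_mul (A := t)]
        push_cast
        ring
      rw [hteq]
      calc ((t / t.minFac : ℕ) : ℝ) * (t.minFac : ℝ)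
          < ((t / t.minFac : ℕ) : ℝ) * ((t / t.minFac).minFac : ℝ) :=
            mul_lt_mul_of_pos_left hqq ht'pos
        _ ≤ ((t / t.minFac : ℕ) : ℝ) * ((t / t.minFac).minFac : ℝ) ^ β :=
            mul_le_mul_of_nonneg_left hq'β ht'pos.le
        _ < D := h2

/-! ### Support of the upper weights: all prime factors below `D^{1/(β+1)}` -/

/-- In the upper truncation set every prime factor `p` of a squarefree `d` satisfies `p^{β+1} < D`
(`β ≥ 0`): the largest prime factor `p₁` is tested at the odd index `1` (`p₁ · p₁^β < D`), and the
other prime factors are smaller (Iwaniec 1980, (4.3): `S⁺_{0,z}` only involves `p ≥ y^{1/(β+1)}`;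
Greaves §3.3.1). [folklore] -/
theorem rpow_lt_of_pred_one (hβ : 0 ≤ β) {d : ℕ} (hd : Squarefree d) (h : pred 1 β D d) :
    ∀ p ∈ d.primeFactors, (p : ℝ) ^ (β + 1) < D := by
  induction d using Nat.strong_induction_on with
  | _ d ih =>
    intro p hp
    have hd0 : d ≠ 0 := hd.ne_zero
    have h1 : d ≠ 1 := fun h1 => by simp [h1] at hp
    have h1d : 1 < d := lt_of_le_of_ne (Nat.one_le_iff_ne_zero.mpr hd0) (Ne.symm h1)
    have hq := Nat.minFac_prime h1
    have hd' : Squarefree (d / d.minFac) :=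
      hd.squarefree_of_dvd (Nat.div_dvd_of_dvd (Nat.minFac_dvd d))
    have hd'0 : d / d.minFac ≠ 0 := hd'.ne_zero
    have hlt : d / d.minFac < d := Nat.div_lt_self (Nat.pos_of_ne_zero hd0) hq.one_lt
    rw [pred_iff h1d] at h
    obtain ⟨h', hc⟩ := h
    have IH := ih _ hlt hd' h'
    -- the prime factors of `d` are those of `d / q` and `q`
    have hpf : d.primeFactors = (d / d.minFac).primeFactors ∪ {d.minFac} := by
      conv_lhs => rw [← div_minFac_mul (A := d)]
      exact primeFactors_mul_prime hq hd'0
    rw [hpf, Finset.mem_union, Finset.mem_singleton] at hp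
    rcases hp with hp | rfl
    · exact IH p hp
    · -- `p = q = minFac d`
      by_cases h1' : d / d.minFac = 1
      · -- `d = q` is prime: index `1` is odd, so `d q^β = q^{β+1} < D`
        have hdq : d = d.minFac := by
          have := Nat.div_mul_cancel (Nat.minFac_dvd d)
          rw [h1', one_mul] at this
          exact this.symm
        have hcard : d.primeFactors.card % 2 = 1 % 2 := by
          rw [hdq, hq.primeFactors, Finset.card_singleton]
        have := hc hcard
        have hq0 : (0 : ℝ) < d.minFac := by exact_mod_cast hq.pos
        rw [Real.rpow_add hq0, Real.rpow_one, mul_comm]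
        calc (d.minFac : ℝ) * (d.minFac : ℝ) ^ β = (d : ℝ) * (d.minFac : ℝ) ^ β := by rw [← hdq]
          _ < D := this
      · -- `q < q' = minFac (d / q)`, a prime factor of `d / q`
        have hq' := Nat.minFac_prime h1'
        have hmem : (d / d.minFac).minFac ∈ (d / d.minFac).primeFactors :=
          Nat.mem_primeFactors.mpr ⟨hq', Nat.minFac_dvd _, hd'0⟩
        have hqq : (d.minFac : ℝ) < (d / d.minFac).minFac := by
          exact_mod_cast minFac_lt_of_mem_primeFactors_div hd h1 hmem
        have hq0 : (0 : ℝ) ≤ d.minFac := Nat.cast_nonneg _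
        calc (d.minFac : ℝ) ^ (β + 1) < ((d / d.minFac).minFac : ℝ) ^ (β + 1) :=
              Real.rpow_lt_rpow hq0 hqq (by linarith)
          _ < D := IH _ hmem

/-- A squarefree number all of whose prime factors are `< z` divides `P(z)`. [folklore] -/
theorem dvd_primesProdBelow_of_primeFactors_lt {d : ℕ} (hd : Squarefree d) {z : ℝ}
    (h : ∀ p ∈ d.primeFactors, (p : ℝ) < z) : d ∣ primesProdBelow z := by
  rw [← Nat.prod_primeFactors_of_squarefree hd, primesProdBelow]
  refine Finset.prod_dvd_prod_of_subset _ _ _ fun p hp => ?_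
  rw [Nat.mem_primesBelow]
  exact ⟨Nat.lt_ceil.mpr (h p hp), Nat.prime_of_mem_primeFactors hp⟩

/-- **The upper main sum does not see primes `≥ D^{1/(β+1)}`**: if `0 < z' ≤ z` and
`D ≤ z'^{β+1}`, then `S⁺(D, z) = S⁺(D, z')`, because `χ⁺(d) = 1` forces all prime factors of `d`
below `D^{1/(β+1)} ≤ z'` (Iwaniec 1980, (4.3) and p. 202: for `s ≤ β + 1` the upper bound reduces to
`s = β + 1`). [folklore] -/
theorem mainSum_one_eq_of_level_le (hβ : 0 ≤ β) (g : ArithmeticFunction ℝ) {z' z : ℝ}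
    (hz' : 0 < z') (hz'z : z' ≤ z) (hD : D ≤ z' ^ (β + 1)) :
    mainSum 1 g β D (primesProdBelow z) = mainSum 1 g β D (primesProdBelow z') := by
  rw [mainSum, mainSum]
  symm
  refine Finset.sum_subset (Nat.divisors_subset_of_dvd (primesProdBelow_ne_zero z)
    (SieveSequence.primesProdBelow_dvd hz'z)) fun d hd hd' => ?_
  -- `d ∣ P(z)`, `d ∤ P(z')`: then `χ⁺(d) = 0`
  have hdP : d ∣ primesProdBelow z := Nat.dvd_of_mem_divisors hd
  have hdsq : Squarefree d := (squarefree_primesProdBelow z).squarefree_of_dvd hdP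
  by_cases hpred : pred 1 β D d
  · exfalso
    refine hd' (Nat.mem_divisors.mpr ⟨dvd_primesProdBelow_of_primeFactors_lt hdsq fun p hp => ?_,
      primesProdBelow_ne_zero z'⟩)
    -- `p^{β+1} < D ≤ z'^{β+1}`, so `p < z'`
    have h1 := rpow_lt_of_pred_one hβ hdsq hpred p hp
    have hp0 : (0 : ℝ) ≤ p := Nat.cast_nonneg p
    by_contra hcon
    have hle : z' ≤ (p : ℝ) := not_lt.mp hcon
    have : z' ^ (β + 1) ≤ (p : ℝ) ^ (β + 1) := Real.rpow_le_rpow hz'.le hle (by linarith)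
    linarith
  · rw [ind_of_not_pred hpred, mul_zero, zero_mul]

end BetaSieve

/-! ### `Ω(κ, L)`: comparison of `V(w)` and `V(z)` -/

namespace HasIwaniecDimension

variable {g : ArithmeticFunction ℝ} {κ L : ℝ}

/-- Under `Ω(κ, L)`: `V(w) ≤ (log z / log w)^κ (1 + L / log w) V(z)` for `2 ≤ w ≤ z`, where
`V(z) = ∏_{p < z} (1 − g(p))` (a restatement of the dimension condition; Iwaniec 1980, (1.3)).
[folklore] -/
theorem vprod_le (h : HasIwaniecDimension g κ L) {w z : ℝ} (hw : 2 ≤ w) (hwz : w ≤ z) :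
    BetaSieve.vprod g (primesProdBelow w) ≤
      (Real.log z / Real.log w) ^ κ * (1 + L / Real.log w) * BetaSieve.vprod g (primesProdBelow z) := by
  have hsplit : BetaSieve.vprod g (primesProdBelow z) = BetaSieve.vprod g (primesProdBelow w) *
      ∏ p ∈ (Nat.primesBelow ⌈z⌉₊).filter (fun p : ℕ => w ≤ (p : ℝ)), (1 - g p) := by
    rw [BetaSieve.vprod, BetaSieve.vprod, primeFactors_primesProdBelow, primeFactors_primesProdBelow,
      ← Finset.prod_filter_mul_prod_filter_not (Nat.primesBelow ⌈z⌉₊) (fun p : ℕ => (p : ℝ) < w)]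
    congr 1
    · refine Finset.prod_congr ?_ fun _ _ => rfl
      ext p
      simp only [Finset.mem_filter, Nat.mem_primesBelow, Nat.lt_ceil]
      constructor
      · rintro ⟨⟨-, hp⟩, hlt⟩; exact ⟨hlt, hp⟩
      · rintro ⟨hlt, hp⟩; exact ⟨⟨lt_of_lt_of_le hlt hwz, hp⟩, hlt⟩
    · refine Finset.prod_congr ?_ fun _ _ => rfl
      exact Finset.filter_congr fun p _ => not_lt
  have hpos :
      0 < ∏ p ∈ (Nat.primesBelow ⌈z⌉₊).filter (fun p : ℕ => w ≤ (p : ℝ)), (1 - g p) :=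
    Finset.prod_pos fun p hp =>
      sub_pos.mpr (h.1 p (Nat.prime_of_mem_primesBelow (Finset.mem_filter.mp hp).1)).2
  have hdim2 := h.2 w z hw hwz
  rw [Finset.prod_inv_distrib] at hdim2
  have hV0 : 0 ≤ BetaSieve.vprod g (primesProdBelow w) :=
    Finset.prod_nonneg fun p hp => (sub_pos.mpr (h.1 p (Nat.prime_of_mem_primeFactors hp)).2).le
  calc BetaSieve.vprod g (primesProdBelow w)
      = BetaSieve.vprod g (primesProdBelow w) *
          ((∏ p ∈ (Nat.primesBelow ⌈z⌉₊).filter (fun p : ℕ => w ≤ (p : ℝ)), (1 - g p))⁻¹ *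
          ∏ p ∈ (Nat.primesBelow ⌈z⌉₊).filter (fun p : ℕ => w ≤ (p : ℝ)), (1 - g p)) := by
        rw [inv_mul_cancel₀ hpos.ne', mul_one]
    _ ≤ BetaSieve.vprod g (primesProdBelow w) *
          (((Real.log z / Real.log w) ^ κ * (1 + L / Real.log w)) *
          ∏ p ∈ (Nat.primesBelow ⌈z⌉₊).filter (fun p : ℕ => w ≤ (p : ℝ)), (1 - g p)) :=
        mul_le_mul_of_nonneg_left (mul_le_mul_of_nonneg_right hdim2 hpos.le) hV0
    _ = (Real.log z / Real.log w) ^ κ * (1 + L / Real.log w) *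
          BetaSieve.vprod g (primesProdBelow z) := by
        rw [hsplit]; ring

/-- Under `Ω(κ, L)` the product `V(z) = ∏_{p < z} (1 − g(p))` is positive (`g(p) < 1`). [folklore] -/
theorem vprod_pos (h : HasIwaniecDimension g κ L) (z : ℝ) :
    0 < BetaSieve.vprod g (primesProdBelow z) :=
  Finset.prod_pos fun p hp => sub_pos.mpr (h.1 p (Nat.prime_of_mem_primeFactors hp)).2

/-- Under `Ω(κ, L)`: `V(z)⁻¹ ≤ (log z / log 2)^κ (1 + L / log 2)` for `z ≥ 2` (case `w = 2`).
[folklore] -/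
theorem inv_vprod_le (h : HasIwaniecDimension g κ L) {z : ℝ} (hz : 2 ≤ z) :
    (BetaSieve.vprod g (primesProdBelow z))⁻¹ ≤
      (Real.log z / Real.log 2) ^ κ * (1 + L / Real.log 2) := by
  have h1 := h.vprod_le le_rfl hz
  rw [SieveSequence.primesProdBelow_two, BetaSieve.vprod, Nat.primeFactors_one, Finset.prod_empty]
    at h1
  have hV := h.vprod_pos z
  rw [inv_le_iff_one_le_mul₀ hV]
  linarith [h1]

end HasIwaniecDimension

/-! ### The main-term estimates of Iwaniec's Theorem 1 (named facts) -/

/-- **Main term of Rosser's sieve, lower bound** (Iwaniec, *Rosser's sieve*, Acta Arith. 36 (1980),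
proof of Theorem 1: the identity (4.2) for `S⁻`, Lemma 20 (range `s ≥ β`) and (9.1)–(9.2) with
(6.5), (7.7), and `f(s) = 1 − s^{−κ} T⁻(s)`, p. 202). For every `κ ≥ 1/2` there
are greatest `β`-sieve data `(F, f, β, A)` of dimension `κ` (Iwaniec's functions and sifting limit
`β = β_κ`, `IsGreatestBetaSieveData`) such that for every `L` there is `C = C(κ, L)` with: for every
multiplicative `g` satisfying `Ω(κ, L)` (`HasIwaniecDimension`) and all `z ≥ 2`, `y ≥ z^β`
(i.e. `s = log y / log z ≥ β`), Rosser's lower weights of level `y` and parameter `β`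
(`BetaSieve.pred 0 β y`, Iwaniec's (3.6)) satisfy
`S⁻(y, z) = ∑_{d ∣ P(z)} μ(d) χ⁻(d) g(d) ≥ V(z) (f(s) − C (log y)^{−1/3})`.
Faithfulness notes: Iwaniec's error factor is `e^{√K} Q(s)` with `Q(s) < exp(−s log s + s log log 3s
+ O(s))` (1.6), bounded for `s ≥ 1`, whence the constant `C(κ, L)` (his (1.3) with `K = L + 2`
follows from `Ω(κ, L)`); primes with `g(p) = 0` contribute nothing to either side; the estimate is
not displayed as a separate theorem in the source but is the analytic half of the proof of Theorem 1
(p. 202: "Theorem 1 follows from (3.4), (3.5), (3.7), (4.1), (4.2), (9.1), (9.2), (6.5) and (7.7)").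
For `s < β` the inequality is false in general (and not needed: `f(s) = 0` there). Greaves,
*Sieves in Number Theory*, Prop. 4.4.1 with Thm 4.4.2 proves the analogous bound for a composite of
Rosser's sieve with a preliminary sieve. [cite: IwaniecActaArith1980, Thm 1 (proof): (4.2), Lemma 20, (9.1)–(9.2), p. 202] -/
def Iwaniec1980_mainTerm_lower : Prop :=
  ∀ {κ : ℝ} (_hκ : 1 / 2 ≤ κ), ∃ B : (ℝ → ℝ) × (ℝ → ℝ) × ℝ × ℝ, IsGreatestBetaSieveData κ B ∧
    ∀ L : ℝ, ∃ C : ℝ, ∀ g : ArithmeticFunction ℝ, g.IsMultiplicative → HasIwaniecDimension g κ L →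
      ∀ y z : ℝ, 2 ≤ z → z ^ B.2.2.1 ≤ y →
        BetaSieve.vprod g (primesProdBelow z) *
            (B.2.1 (Real.log y / Real.log z) - C * Real.log y ^ (-(1 / 3 : ℝ))) ≤
          BetaSieve.mainSum 0 g B.2.2.1 y (primesProdBelow z)

/-- **Main term of Rosser's sieve, upper bound** (Iwaniec, *Rosser's sieve*, Acta Arith. 36 (1980),
proof of Theorem 1: the identity (4.1) for `S⁺`, Lemma 20 (range `s ≥ β − 1`) and (9.1)–(9.2)
with (6.5), (7.7), and `F(s) = 1 + s^{−κ} T⁺(s)`, p. 202; for `β − 1 < s ≤ β + 1`,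
`s^κ F(s) = (β + 1)^κ F(β + 1)` by (7.3)). For every `κ ≥ 1/2` there are greatest `β`-sieve
data `(F, f, β, A)` of dimension `κ` (`IsGreatestBetaSieveData`) such that for every `L` there is
`C = C(κ, L)` with: for every multiplicative `g` satisfying `Ω(κ, L)` and all `2 ≤ z ≤ y` with
`y ≥ z^{β−1}` (i.e. `s ≥ max(1, β − 1)`), Rosser's upper weights of level `y` and parameter `β`
(`BetaSieve.pred 1 β y`) satisfy
`S⁺(y, z) = ∑_{d ∣ P(z)} μ(d) χ⁺(d) g(d) ≤ V(z) (F(s) + C (log y)^{−1/3})`.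
(Same faithfulness notes as `Iwaniec1980_mainTerm_lower`; the remaining range `1 ≤ s < β − 1` of
Theorem 1 follows from the case `s = β + 1`, see `Iwaniec1980_thm1_upper_of_mainTerm`.)
[cite: IwaniecActaArith1980, Thm 1 (proof): (4.1), Lemma 20, (9.1)–(9.2), p. 202] -/
def Iwaniec1980_mainTerm_upper : Prop :=
  ∀ {κ : ℝ} (_hκ : 1 / 2 ≤ κ), ∃ B : (ℝ → ℝ) × (ℝ → ℝ) × ℝ × ℝ, IsGreatestBetaSieveData κ B ∧
    ∀ L : ℝ, ∃ C : ℝ, ∀ g : ArithmeticFunction ℝ, g.IsMultiplicative → HasIwaniecDimension g κ L →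
      ∀ y z : ℝ, 2 ≤ z → z ≤ y → z ^ (B.2.2.1 - 1) ≤ y →
        BetaSieve.mainSum 1 g B.2.2.1 y (primesProdBelow z) ≤
          BetaSieve.vprod g (primesProdBelow z) *
            (B.1 (Real.log y / Real.log z) + C * Real.log y ^ (-(1 / 3 : ℝ)))

/-! ### Rosser's weights applied to a sifted sequence -/

namespace SieveSequence

open BetaSieve

variable (A : SieveSequence)

/-- Splitting `A_d = g(d) X + R_d` in the weighted sum of Rosser's weights over `d ∣ P`:
`∑ μ(d) χ(d) A_d(x) = X S^{par} + ∑ μ(d) χ(d) R_d(x)` (Iwaniec 1980, (3.4)–(3.5)). [folklore] -/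
theorem indSum_congrSum_eq (par : ℕ) (β D : ℝ) (P : ℕ) (x : ℝ) :
    ∑ d ∈ P.divisors, (μ d : ℝ) * ind par β D d * A.congrSum d x =
      A.size x * mainSum par A.density β D P +
        ∑ d ∈ P.divisors, (μ d : ℝ) * ind par β D d * A.remainder d x := by
  rw [mainSum, Finset.mul_sum, ← Finset.sum_add_distrib]
  refine Finset.sum_congr rfl fun d _ => ?_
  rw [remainder]
  ring

/-- The weighted remainder of Rosser's weights of level `y ≥ z ≥ 2`, `β ≥ 1`, is dominated by the
remainder sum of Theorem 1: `|∑_{d ∣ P(z)} μ(d) χ(d) R_d(x)| ≤ ∑_{d < y, d ∣ P(z)} |R_d(x)|`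
(Iwaniec 1980, (3.7)). [folklore] -/
theorem abs_sum_ind_remainder_le (par : ℕ) {β y z : ℝ} (hβ : 1 ≤ β) (hz : 2 ≤ z) (hzy : z ≤ y)
    (x : ℝ) :
    |∑ d ∈ (primesProdBelow z).divisors, (μ d : ℝ) * ind par β y d * A.remainder d x| ≤
      ∑ d ∈ (Finset.range ⌈y⌉₊).filter (· ∣ primesProdBelow z), |A.remainder d x| := by
  set P := primesProdBelow z with hP
  have hPsq : Squarefree P := squarefree_primesProdBelow z
  have hy1 : 1 < y := by linarith
  -- termwise: `|μ χ R_d| ≤ [χ(d) = 1] |R_d|`, and `χ(d) = 1 ⇒ d < y`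
  calc |∑ d ∈ P.divisors, (μ d : ℝ) * ind par β y d * A.remainder d x|
      ≤ ∑ d ∈ P.divisors, |(μ d : ℝ) * ind par β y d * A.remainder d x| :=
        Finset.abs_sum_le_sum_abs _ _
    _ ≤ ∑ d ∈ P.divisors, (if (d : ℝ) < y then |A.remainder d x| else 0) := by
        refine Finset.sum_le_sum fun d hd => ?_
        by_cases hpred : pred par β y d
        · have hdd : d ∣ P := Nat.dvd_of_mem_divisors hd
          have hlt : (d : ℝ) < y := lt_level_of_pred_of_one_le hβ hy1 hzy
            (hPsq.squarefree_of_dvd hdd) (fun p hp => prime_lt_of_mem_primeFactors_of_dvd hdd hp)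
            hpred
          rw [if_pos hlt, abs_mul, abs_mul]
          have hμ : |(μ d : ℝ)| ≤ 1 := by exact_mod_cast ArithmeticFunction.abs_moebius_le_one
          calc |(μ d : ℝ)| * |ind par β y d| * |A.remainder d x| ≤ 1 * 1 * |A.remainder d x| := by
                gcongr
                · exact abs_ind_le_one d
            _ = |A.remainder d x| := by ring
        · rw [ind_of_not_pred hpred, mul_zero, zero_mul, abs_zero]
          split_ifs
          · exact abs_nonneg _
          · exact le_rfl
    _ = ∑ d ∈ P.divisors.filter (fun d : ℕ => (d : ℝ) < y), |A.remainder d x| := by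
        rw [Finset.sum_filter]
    _ ≤ ∑ d ∈ (Finset.range ⌈y⌉₊).filter (· ∣ P), |A.remainder d x| := by
        refine Finset.sum_le_sum_of_subset_of_nonneg (fun d hd => ?_) fun _ _ _ => abs_nonneg _
        rw [Finset.mem_filter] at hd ⊢
        rw [Finset.mem_range]
        exact ⟨Nat.lt_ceil.mpr hd.2, Nat.dvd_of_mem_divisors hd.1⟩

end SieveSequence

/-! ### The upper main sum in the full range `1 ≤ s` -/

/-- The constant `C'(κ, L)` of `mainSum_one_le_of_mainTerm_upper`, in terms of Iwaniec's `β, A` (here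
`β, a`), `κ`, `L` and the constant `C` of `Iwaniec1980_mainTerm_upper`. [folklore] -/
def upperMainTermConst (κ L C β a : ℝ) : ℝ :=
  max C 0 * (β + 1) ^ κ * (1 + L * (β + 1)) + a * L * (β + 1) +
    (β + 1) ^ κ * (1 + L / Real.log 2) * ((β + 1) * Real.log 2) ^ (1 / 3 : ℝ) + max C 0

/-- `max C 0 ≤ C'`. [folklore] -/
theorem max_le_upperMainTermConst {κ L C β a : ℝ} (hL : 0 ≤ L) (hβ : 1 ≤ β) (ha : 0 ≤ a) :
    max C 0 ≤ upperMainTermConst κ L C β a := by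
  unfold upperMainTermConst
  have hβ0 : 0 < β := by linarith
  have h1 : 0 ≤ (β + 1) ^ κ := Real.rpow_nonneg (by linarith) κ
  have h2 : 0 ≤ ((β + 1) * Real.log 2) ^ (1 / 3 : ℝ) :=
    Real.rpow_nonneg (mul_nonneg (by linarith) (Real.log_nonneg one_le_two)) _
  have h3 : 0 ≤ 1 + L / Real.log 2 := by
    have := Real.log_pos one_lt_two; positivity
  have h4 : 0 ≤ max C 0 := le_max_right C 0
  have h5 : 0 ≤ 1 + L * (β + 1) := by
    have := mul_nonneg hL (show (0 : ℝ) ≤ β + 1 by linarith); linarith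
  have : 0 ≤ max C 0 * (β + 1) ^ κ * (1 + L * (β + 1)) := by positivity
  have : 0 ≤ a * L * (β + 1) := by positivity
  have : 0 ≤ (β + 1) ^ κ * (1 + L / Real.log 2) * ((β + 1) * Real.log 2) ^ (1 / 3 : ℝ) := by
    positivity
  linarith

/-- **The upper main sum for all `1 ≤ s`** (Iwaniec 1980, p. 202: `s^κ F(s) = (β + 1)^κ F(β + 1)` for
`1 ≤ s ≤ β + 1`). If `(F, f, β, a)` solve the normalised system and the upper main-term estimate
holds for `s ≥ max(1, β − 1)` with constant `C`, then for all `2 ≤ z ≤ y`,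
`S⁺(y, z) ≤ V(z) (F(s) + C' (log y)^{−1/3})` with `C' = upperMainTermConst κ L C β a`. For
`s < β − 1` one has `S⁺(y, z) = S⁺(y, z')`, `z' = y^{1/(β+1)}` (`BetaSieve.mainSum_one_eq_of_level_le`);
if `z' ≥ 2` the estimate at `(y, z')` (`s' = β + 1`) and
`V(z') ≤ ((β + 1)/s)^κ (1 + (β + 1) L / log y) V(z)` (`Ω(κ, L)`) give the claim since
`((β + 1)/s)^κ F(β + 1) = a s^{−κ} = F(s)`; if `z' < 2` then `S⁺ = 1 ≤ V(z) C' (log y)^{−1/3}`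
because `V(z)⁻¹ ≤ (β + 1)^κ (1 + L / log 2)` and `log y < (β + 1) log 2`. [folklore] -/
theorem mainSum_one_le_of_mainTerm_upper {κ L C : ℝ} {F f : ℝ → ℝ} {β a : ℝ} (hκ : 0 < κ)
    (hsol : IsBetaSieveSolution κ F f β a)
    (hC : ∀ g : ArithmeticFunction ℝ, g.IsMultiplicative → HasIwaniecDimension g κ L →
      ∀ y z : ℝ, 2 ≤ z → z ≤ y → z ^ (β - 1) ≤ y →
        BetaSieve.mainSum 1 g β y (primesProdBelow z) ≤
          BetaSieve.vprod g (primesProdBelow z) *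
            (F (Real.log y / Real.log z) + C * Real.log y ^ (-(1 / 3 : ℝ))))
    {g : ArithmeticFunction ℝ} (hg : g.IsMultiplicative) (hdim : HasIwaniecDimension g κ L)
    {y z : ℝ} (hz : 2 ≤ z) (hzy : z ≤ y) :
    BetaSieve.mainSum 1 g β y (primesProdBelow z) ≤
      BetaSieve.vprod g (primesProdBelow z) *
        (F (Real.log y / Real.log z) + upperMainTermConst κ L C β a * Real.log y ^ (-(1 / 3 : ℝ))) := by
  -- notation
  have hβ1 : 1 ≤ β := hsol.one_le
  have hβ0 : 0 < β := by linarith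
  have ha : 0 < a := hsol.pos
  have hL : 0 ≤ L := hdim.nonneg
  have hz0 : 0 < z := by linarith
  have hz1 : 1 < z := by linarith
  have hy0 : 0 < y := by linarith
  have hy1 : 1 < y := by linarith
  have hlz : 0 < Real.log z := Real.log_pos hz1
  have hly : 0 < Real.log y := Real.log_pos hy1
  have hly' : Real.log y ≠ 0 := hly.ne'
  have hlz' : Real.log z ≠ 0 := hlz.ne'
  have hlog2 : 0 < Real.log 2 := Real.log_pos one_lt_two
  have hb1 : 0 < β + 1 := by linarith
  have hb1' : β + 1 ≠ 0 := hb1.ne'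
  have hbκ : 0 < (β + 1) ^ κ := Real.rpow_pos_of_pos hb1 κ
  set s := Real.log y / Real.log z with hsdef
  have hs0 : 0 < s := by rw [hsdef]; exact div_pos hly hlz
  have hs1 : 1 ≤ s := by rw [hsdef, le_div_iff₀ hlz, one_mul]; exact Real.log_le_log hz0 hzy
  set ℓ := Real.log y ^ (-(1 / 3 : ℝ)) with hℓdef
  have hℓ0 : 0 < ℓ := by rw [hℓdef]; exact Real.rpow_pos_of_pos hly _
  set V := BetaSieve.vprod g (primesProdBelow z) with hVdef
  have hV : 0 < V := by rw [hVdef]; exact hdim.vprod_pos z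
  set M := max C 0 with hMdef
  have hM0 : 0 ≤ M := by rw [hMdef]; exact le_max_right C 0
  have hCM : C ≤ M := by rw [hMdef]; exact le_max_left C 0
  set C' := upperMainTermConst κ L C β a with hC'def
  -- the pieces of `C'`
  set T1 := M * (β + 1) ^ κ * (1 + L * (β + 1)) with hT1
  set T2 := a * L * (β + 1) with hT2
  set T3 := (β + 1) ^ κ * (1 + L / Real.log 2) * ((β + 1) * Real.log 2) ^ (1 / 3 : ℝ) with hT3
  have hT1n : 0 ≤ T1 := by rw [hT1]; positivity
  have hT2n : 0 ≤ T2 := by rw [hT2]; positivity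
  have hT3n : 0 ≤ T3 := by rw [hT3]; positivity
  have hC'eq : C' = T1 + T2 + T3 + M := by
    rw [hC'def, hT1, hT2, hT3, hMdef, upperMainTermConst]
  have hMC' : M ≤ C' := by rw [hC'eq]; linarith
  -- `F(t) = a t^{-κ}` for `0 < t ≤ β + 1`
  have hFpos : ∀ t : ℝ, 0 < t → t ≤ β + 1 → F t = a * t ^ (-κ) := fun t ht htb =>
    hsol.upper_eq t ⟨ht, htb⟩
  by_cases hcase : z ^ (β - 1) ≤ y
  · -- range of the fact: `s ≥ β - 1`
    have h := hC g hg hdim y z hz hzy hcase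
    rw [← hVdef, ← hsdef, ← hℓdef] at h
    refine h.trans (mul_le_mul_of_nonneg_left ?_ hV.le)
    have : C * ℓ ≤ C' * ℓ := mul_le_mul_of_nonneg_right (hCM.trans hMC') hℓ0.le
    linarith
  -- now `s < β - 1`; put `z' = y^{1/(β+1)}`
  push Not at hcase
  have hlogy_lt : Real.log y < (β - 1) * Real.log z := by
    have := Real.log_lt_log hy0 hcase
    rwa [Real.log_rpow hz0] at this
  have hsβ : s < β - 1 := by rwa [hsdef, div_lt_iff₀ hlz]
  have hβ2 : 2 < β := by linarith
  have hsb : s ≤ β + 1 := by linarith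
  have hFs : F s = a * s ^ (-κ) := hFpos s hs0 hsb
  have hFs0 : 0 ≤ F s := by rw [hFs]; exact (mul_pos ha (Real.rpow_pos_of_pos hs0 _)).le
  obtain ⟨z', hz'⟩ : ∃ z' : ℝ, z' = Real.exp (Real.log y / (β + 1)) := ⟨_, rfl⟩
  have hz'0 : 0 < z' := by rw [hz']; exact Real.exp_pos _
  have hlogz' : Real.log z' = Real.log y / (β + 1) := by rw [hz', Real.log_exp]
  have hz'pow : z' ^ (β + 1) = y := by
    rw [hz', ← Real.exp_mul, div_mul_cancel₀ _ hb1', Real.exp_log hy0]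
  have hz'z : z' ≤ z := by
    calc z' = Real.exp (Real.log y / (β + 1)) := hz'
      _ ≤ Real.exp (Real.log z) := by
          refine Real.exp_le_exp.mpr ?_
          rw [div_le_iff₀ hb1]
          have := mul_le_mul_of_nonneg_right (show β - 1 ≤ β + 1 by linarith) hlz.le
          linarith
      _ = z := Real.exp_log hz0
  have hMeq : BetaSieve.mainSum 1 g β y (primesProdBelow z) =
      BetaSieve.mainSum 1 g β y (primesProdBelow z') :=
    BetaSieve.mainSum_one_eq_of_level_le hβ0.le g hz'0 hz'z hz'pow.ge
  rw [hMeq]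
  by_cases h2 : 2 ≤ z'
  · -- `z' ≥ 2`: the fact at `(y, z')`, `s' = β + 1`
    have hz'y : z' ≤ y := by
      calc z' = Real.exp (Real.log y / (β + 1)) := hz'
        _ ≤ Real.exp (Real.log y) := by
            refine Real.exp_le_exp.mpr ?_
            rw [div_le_iff₀ hb1]
            have := mul_nonneg hly.le hβ0.le
            linarith
        _ = y := Real.exp_log hy0
    have hz'y' : z' ^ (β - 1) ≤ y := by
      calc z' ^ (β - 1) = Real.exp (Real.log y / (β + 1) * (β - 1)) := by rw [hz', ← Real.exp_mul]
        _ ≤ Real.exp (Real.log y) := by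
            refine Real.exp_le_exp.mpr ?_
            rw [div_mul_eq_mul_div, div_le_iff₀ hb1]
            linarith
        _ = y := Real.exp_log hy0
    have hfact := hC g hg hdim y z' h2 hz'y hz'y'
    have hs' : Real.log y / Real.log z' = β + 1 := by
      rw [hlogz', div_div_eq_mul_div, mul_div_right_comm, div_self hly', one_mul]
    rw [hs', ← hℓdef] at hfact
    set V' := BetaSieve.vprod g (primesProdBelow z') with hV'def
    have hV' : 0 < V' := by rw [hV'def]; exact hdim.vprod_pos z'
    have hFb : F (β + 1) = a * (β + 1) ^ (-κ) := hFpos (β + 1) hb1 le_rfl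
    have hFb0 : 0 < F (β + 1) := by rw [hFb]; exact mul_pos ha (Real.rpow_pos_of_pos hb1 _)
    -- `V' ≤ r^κ (1 + L / log z') V`, `r = (β+1)/s`
    have hcomp := hdim.vprod_le h2 hz'z
    rw [← hVdef, ← hV'def] at hcomp
    have hratio : Real.log z / Real.log z' = (β + 1) / s := by
      rw [hlogz', hsdef, div_div_eq_mul_div, div_div_eq_mul_div, mul_comm]
    rw [hratio, hlogz'] at hcomp
    set r := (β + 1) / s with hrdef
    have hr0 : 0 < r := by rw [hrdef]; exact div_pos hb1 hs0
    have hr1 : r ≤ β + 1 := by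
      rw [hrdef, div_le_iff₀ hs0]
      have := mul_nonneg hb1.le (show (0 : ℝ) ≤ s - 1 by linarith)
      linarith
    have hrκ : r ^ κ ≤ (β + 1) ^ κ := Real.rpow_le_rpow hr0.le hr1 hκ.le
    have hrκ0 : 0 < r ^ κ := Real.rpow_pos_of_pos hr0 κ
    -- `log y ≥ 1` (indeed `y ≥ 2^{β+1} ≥ 8`)
    have hly1 : 1 ≤ Real.log y := by
      have h8 : 3 * Real.log 2 ≤ Real.log y := by
        have := Real.log_le_log (by norm_num) h2
        rw [hlogz', le_div_iff₀ hb1] at this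
        have := mul_nonneg hlog2.le (show (0 : ℝ) ≤ β - 2 by linarith)
        linarith
      linarith [Real.log_two_gt_d9]
    have hinvℓ : (Real.log y)⁻¹ ≤ ℓ := by
      rw [hℓdef, ← Real.rpow_neg_one]
      exact Real.rpow_le_rpow_of_exponent_le hly1 (by norm_num)
    have hinv1 : (Real.log y)⁻¹ ≤ 1 := inv_le_one_of_one_le₀ hly1
    have hinv0 : 0 < (Real.log y)⁻¹ := inv_pos.mpr hly
    -- the key identity `r^κ F(β+1) = F(s)`
    have hsκ0 : s ^ κ ≠ 0 := (Real.rpow_pos_of_pos hs0 κ).ne'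
    have hbκ0 : (β + 1) ^ κ ≠ 0 := hbκ.ne'
    have hkey : r ^ κ * F (β + 1) = F s := by
      rw [hFb, hFs, hrdef, Real.div_rpow hb1.le hs0.le, Real.rpow_neg hb1.le, Real.rpow_neg hs0.le]
      field_simp
    -- assemble
    have hLdiv : L / (Real.log y / (β + 1)) = L * (β + 1) * (Real.log y)⁻¹ := by
      rw [div_div_eq_mul_div, div_eq_mul_inv]
    have hfac0 : 0 ≤ 1 + L * (β + 1) * (Real.log y)⁻¹ := by positivity
    calc BetaSieve.mainSum 1 g β y (primesProdBelow z')
        ≤ V' * (F (β + 1) + C * ℓ) := hfact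
      _ ≤ V' * (F (β + 1) + M * ℓ) := by
          refine mul_le_mul_of_nonneg_left ?_ hV'.le
          have := mul_le_mul_of_nonneg_right hCM hℓ0.le
          linarith
      _ ≤ (r ^ κ * (1 + L / (Real.log y / (β + 1))) * V) * (F (β + 1) + M * ℓ) := by
          refine mul_le_mul_of_nonneg_right hcomp ?_
          have := hFb0.le; positivity
      _ = V * (F s * (1 + L * (β + 1) * (Real.log y)⁻¹) +
            r ^ κ * (1 + L * (β + 1) * (Real.log y)⁻¹) * M * ℓ) := by
          rw [hLdiv, ← hkey]; ring
      _ ≤ V * (F s + (T1 + T2 + T3 + M) * ℓ) := by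
          refine mul_le_mul_of_nonneg_left ?_ hV.le
          -- `F s · L(β+1)/log y ≤ a L (β+1) ℓ = T2 ℓ`
          have hsκ : s ^ (-κ) ≤ 1 := Real.rpow_le_one_of_one_le_of_nonpos hs1 (by linarith)
          have hFa : F s ≤ a := by rw [hFs]; exact mul_le_of_le_one_right ha.le hsκ
          have e1 : F s * (L * (β + 1) * (Real.log y)⁻¹) ≤ T2 * ℓ := by
            rw [hT2]
            calc F s * (L * (β + 1) * (Real.log y)⁻¹) ≤ a * (L * (β + 1) * (Real.log y)⁻¹) :=
                  mul_le_mul_of_nonneg_right hFa (by positivity)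
              _ = a * L * (β + 1) * (Real.log y)⁻¹ := by ring
              _ ≤ a * L * (β + 1) * ℓ := mul_le_mul_of_nonneg_left hinvℓ (by positivity)
          -- `r^κ (1 + L(β+1)/log y) M ℓ ≤ (β+1)^κ (1 + L(β+1)) M ℓ = T1 ℓ`
          have e2 : r ^ κ * (1 + L * (β + 1) * (Real.log y)⁻¹) * M * ℓ ≤ T1 * ℓ := by
            rw [hT1]
            have h3 : 1 + L * (β + 1) * (Real.log y)⁻¹ ≤ 1 + L * (β + 1) := by
              have : L * (β + 1) * (Real.log y)⁻¹ ≤ L * (β + 1) * 1 :=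
                mul_le_mul_of_nonneg_left hinv1 (by positivity)
              linarith
            have h5 : r ^ κ * (1 + L * (β + 1) * (Real.log y)⁻¹) ≤ (β + 1) ^ κ * (1 + L * (β + 1)) :=
              mul_le_mul hrκ h3 hfac0 hbκ.le
            have := mul_le_mul_of_nonneg_right (mul_le_mul_of_nonneg_right h5 hM0) hℓ0.le
            linarith
          have e3 : 0 ≤ (T3 + M) * ℓ := by positivity
          linarith [e1, e2, e3]
      _ = V * (F s + C' * ℓ) := by rw [hC'eq]
  · -- `z' < 2`: no upper weights beyond `d = 1`, `S⁺ = 1`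
    push Not at h2
    have hP1 : primesProdBelow z' = 1 := by
      have := SieveSequence.primesProdBelow_dvd h2.le
      rwa [SieveSequence.primesProdBelow_two, Nat.dvd_one] at this
    rw [hP1, BetaSieve.mainSum_one hg]
    -- `log y < (β + 1) log 2`
    have hly2 : Real.log y < (β + 1) * Real.log 2 := by
      have := Real.log_lt_log hz'0 h2
      rwa [hlogz', div_lt_iff₀ hb1, mul_comm] at this
    -- `V⁻¹ ≤ (β+1)^κ (1 + L / log 2)`
    have hW : V⁻¹ ≤ (β + 1) ^ κ * (1 + L / Real.log 2) := by
      have hW0 := hdim.inv_vprod_le hz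
      rw [← hVdef] at hW0
      refine hW0.trans ?_
      have h3 : Real.log z / Real.log 2 ≤ β + 1 := by
        rw [div_le_iff₀ hlog2]
        have := Real.log_le_log hz0 hzy
        linarith
      have h4 : (Real.log z / Real.log 2) ^ κ ≤ (β + 1) ^ κ :=
        Real.rpow_le_rpow (div_nonneg hlz.le hlog2.le) h3 hκ.le
      have h5 : 0 ≤ 1 + L / Real.log 2 := by positivity
      exact mul_le_mul_of_nonneg_right h4 h5
    -- `ℓ ≥ ((β+1) log 2)^{-1/3}`
    have hℓlow : ((β + 1) * Real.log 2) ^ (-(1 / 3 : ℝ)) ≤ ℓ := by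
      rw [hℓdef]
      exact Real.rpow_le_rpow_of_nonpos hly hly2.le (by norm_num)
    have hbl : 0 < (β + 1) * Real.log 2 := mul_pos hb1 hlog2
    have hT3ℓ : (β + 1) ^ κ * (1 + L / Real.log 2) ≤ T3 * ℓ := by
      rw [hT3]
      have h6 : ((β + 1) * Real.log 2) ^ (1 / 3 : ℝ) * ((β + 1) * Real.log 2) ^ (-(1 / 3 : ℝ)) = 1 := by
        rw [Real.rpow_neg hbl.le, mul_inv_cancel₀ (Real.rpow_pos_of_pos hbl _).ne']
      have h7 : 0 ≤ (β + 1) ^ κ * (1 + L / Real.log 2) * ((β + 1) * Real.log 2) ^ (1 / 3 : ℝ) := by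
        positivity
      calc (β + 1) ^ κ * (1 + L / Real.log 2)
          = (β + 1) ^ κ * (1 + L / Real.log 2) * (((β + 1) * Real.log 2) ^ (1 / 3 : ℝ) *
              ((β + 1) * Real.log 2) ^ (-(1 / 3 : ℝ))) := by rw [h6, mul_one]
        _ = (β + 1) ^ κ * (1 + L / Real.log 2) * ((β + 1) * Real.log 2) ^ (1 / 3 : ℝ) *
              ((β + 1) * Real.log 2) ^ (-(1 / 3 : ℝ)) := by ring
        _ ≤ (β + 1) ^ κ * (1 + L / Real.log 2) * ((β + 1) * Real.log 2) ^ (1 / 3 : ℝ) * ℓ :=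
              mul_le_mul_of_nonneg_left hℓlow h7
    have hVinv : 1 ≤ V * (T3 * ℓ) := by
      have := mul_le_mul_of_nonneg_left (hW.trans hT3ℓ) hV.le
      rwa [mul_inv_cancel₀ hV.ne'] at this
    have hrest : 0 ≤ V * (F s + (T1 + T2 + M) * ℓ) := by positivity
    calc (1 : ℝ) ≤ V * (T3 * ℓ) := hVinv
      _ ≤ V * (T3 * ℓ) + V * (F s + (T1 + T2 + M) * ℓ) := le_add_of_nonneg_right hrest
      _ = V * (F s + C' * ℓ) := by rw [hC'eq]; ring

/-! ### Theorem 1 from the main-term estimates -/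

open BetaSieve

/-- **`Iwaniec1980_mainTerm_lower` implies `Iwaniec1980_thm1_lower`** (Iwaniec 1980, p. 202: the
lower bound (1.5) of Theorem 1 from (3.5), (3.7) and the main-term estimate). For `s ≥ β`:
`S(𝒜, z) ≥ ∑ μ χ⁻ A_d = X S⁻ + ∑ μ χ⁻ R_d ≥ X V(z) (f(s) − C (log y)^{−1/3}) − ∑_{d<y, d∣P(z)} |R_d|`
(`lowerSum_le_sifted`, the fact, `X ≥ 0`, (3.7)); for `1 ≤ s < β` the main term is `≤ 0 ≤ S(𝒜, z)`
since `f(s) = 0` (`IsBetaSieveSolution.lower_eq`) and `C ≥ 0` may be assumed. [folklore] -/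
theorem Iwaniec1980_thm1_lower_of_mainTerm (h : Iwaniec1980_mainTerm_lower) :
    Iwaniec1980_thm1_lower := by
  intro κ hκ
  obtain ⟨B, hB, hC⟩ := h hκ
  refine ⟨B, hB, fun L => ?_⟩
  obtain ⟨C, hC⟩ := hC L
  refine ⟨max C 0, fun A hdim x y z hz hzy hX => ?_⟩
  obtain ⟨F, f, β, a⟩ := B
  have hsol : IsBetaSieveSolution κ F f β a := hB.1
  have hβ1 : 1 ≤ β := hsol.one_le
  have hPsq : Squarefree (primesProdBelow z) := squarefree_primesProdBelow z
  have hV : 0 < A.densityProduct (primesProdBelow z) := hdim.densityProduct_pos z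
  have hz0 : 0 < z := by linarith
  have hz1 : 1 < z := by linarith
  have hy1 : 1 < y := by linarith
  have hlz : 0 < Real.log z := Real.log_pos hz1
  have hly : 0 < Real.log y := Real.log_pos hy1
  have hs0 : 0 < Real.log y / Real.log z := div_pos hly hlz
  have hℓ0 : 0 ≤ Real.log y ^ (-(1 / 3 : ℝ)) := Real.rpow_nonneg hly.le _
  have hR0 : 0 ≤ ∑ d ∈ (Finset.range ⌈y⌉₊).filter (· ∣ primesProdBelow z), |A.remainder d x| :=
    Finset.sum_nonneg fun _ _ => abs_nonneg _
  have hS0 : 0 ≤ A.sifted x (primesProdBelow z) := Finset.sum_nonneg fun n _ => A.a_nonneg n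
  have hM0 : 0 ≤ max C 0 * Real.log y ^ (-(1 / 3 : ℝ)) := mul_nonneg (le_max_right C 0) hℓ0
  have hXV : 0 ≤ A.size x * A.densityProduct (primesProdBelow z) := mul_nonneg hX hV.le
  change A.size x * A.densityProduct (primesProdBelow z) *
      (f (Real.log y / Real.log z) - max C 0 * Real.log y ^ (-(1 / 3 : ℝ))) -
      ∑ d ∈ (Finset.range ⌈y⌉₊).filter (· ∣ primesProdBelow z), |A.remainder d x| ≤
    A.sifted x (primesProdBelow z)
  by_cases hcase : z ^ β ≤ y
  · -- main case `s ≥ β`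
    have hmain := hC A.density A.density_mult hdim y z hz hcase
    change A.densityProduct (primesProdBelow z) *
        (f (Real.log y / Real.log z) - C * Real.log y ^ (-(1 / 3 : ℝ))) ≤
      mainSum 0 A.density β y (primesProdBelow z) at hmain
    have hsieve := A.lowerSum_le_sifted (β := β) (D := y) x hPsq
    rw [A.indSum_congrSum_eq] at hsieve
    have hrem := (abs_le.mp (A.abs_sum_ind_remainder_le 0 hβ1 hz hzy x)).1
    -- `X V (f − max C 0 ℓ) ≤ X V (f − C ℓ) ≤ X · S⁻`
    have h1 : A.size x * A.densityProduct (primesProdBelow z) *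
        (f (Real.log y / Real.log z) - max C 0 * Real.log y ^ (-(1 / 3 : ℝ))) ≤
        A.size x * (A.densityProduct (primesProdBelow z) *
          (f (Real.log y / Real.log z) - C * Real.log y ^ (-(1 / 3 : ℝ)))) := by
      rw [mul_assoc]
      refine mul_le_mul_of_nonneg_left (mul_le_mul_of_nonneg_left ?_ hV.le) hX
      have := mul_le_mul_of_nonneg_right (le_max_left C 0) hℓ0
      linarith
    have h2 : A.size x * (A.densityProduct (primesProdBelow z) *
          (f (Real.log y / Real.log z) - C * Real.log y ^ (-(1 / 3 : ℝ)))) ≤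
        A.size x * mainSum 0 A.density β y (primesProdBelow z) :=
      mul_le_mul_of_nonneg_left hmain hX
    linarith
  · -- trivial case `s < β`: `f(s) = 0`
    push Not at hcase
    have hsβ : Real.log y / Real.log z ≤ β := by
      rw [div_le_iff₀ hlz]
      have := Real.log_lt_log (by linarith) hcase
      rw [Real.log_rpow hz0] at this
      linarith
    have hfs : f (Real.log y / Real.log z) = 0 := hsol.lower_eq _ ⟨hs0, hsβ⟩
    rw [hfs, zero_sub]
    have := mul_nonneg hXV hM0
    linarith

/-- **`Iwaniec1980_mainTerm_upper` implies `Iwaniec1980_thm1_upper`** (Iwaniec 1980, p. 202: the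
upper bound (1.4) of Theorem 1 from (3.4), (3.7) and the main-term estimate, extended to all
`1 ≤ s` by `mainSum_one_le_of_mainTerm_upper`):
`S(𝒜, z) ≤ ∑ μ χ⁺ A_d = X S⁺ + ∑ μ χ⁺ R_d ≤ X V(z) (F(s) + C' (log y)^{−1/3}) + ∑_{d<y, d∣P(z)} |R_d|`.
[folklore] -/
theorem Iwaniec1980_thm1_upper_of_mainTerm (h : Iwaniec1980_mainTerm_upper) :
    Iwaniec1980_thm1_upper := by
  intro κ hκ
  obtain ⟨B, hB, hC⟩ := h hκ
  refine ⟨B, hB, fun L => ?_⟩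
  obtain ⟨C, hC⟩ := hC L
  obtain ⟨F, f, β, a⟩ := B
  have hsol : IsBetaSieveSolution κ F f β a := hB.1
  have hβ1 : 1 ≤ β := hsol.one_le
  have hκ0 : 0 < κ := by linarith
  have hC' : ∀ g : ArithmeticFunction ℝ, g.IsMultiplicative → HasIwaniecDimension g κ L →
      ∀ y z : ℝ, 2 ≤ z → z ≤ y → z ^ (β - 1) ≤ y →
        BetaSieve.mainSum 1 g β y (primesProdBelow z) ≤
          BetaSieve.vprod g (primesProdBelow z) *
            (F (Real.log y / Real.log z) + C * Real.log y ^ (-(1 / 3 : ℝ))) := hC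
  refine ⟨upperMainTermConst κ L C β a, fun A hdim x y z hz hzy hX => ?_⟩
  have hPsq : Squarefree (primesProdBelow z) := squarefree_primesProdBelow z
  change A.sifted x (primesProdBelow z) ≤
    A.size x * A.densityProduct (primesProdBelow z) *
        (F (Real.log y / Real.log z) + upperMainTermConst κ L C β a * Real.log y ^ (-(1 / 3 : ℝ))) +
      ∑ d ∈ (Finset.range ⌈y⌉₊).filter (· ∣ primesProdBelow z), |A.remainder d x|
  have hmain := mainSum_one_le_of_mainTerm_upper hκ0 hsol hC' A.density_mult hdim hz hzy
  change mainSum 1 A.density β y (primesProdBelow z) ≤ A.densityProduct (primesProdBelow z) *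
      (F (Real.log y / Real.log z) + upperMainTermConst κ L C β a * Real.log y ^ (-(1 / 3 : ℝ)))
    at hmain
  have hsieve := A.sifted_le_upperSum (β := β) (D := y) x hPsq
  rw [A.indSum_congrSum_eq] at hsieve
  have hrem := (abs_le.mp (A.abs_sum_ind_remainder_le 1 hβ1 hz hzy x)).2
  have h2 : A.size x * mainSum 1 A.density β y (primesProdBelow z) ≤
      A.size x * (A.densityProduct (primesProdBelow z) *
        (F (Real.log y / Real.log z) + upperMainTermConst κ L C β a * Real.log y ^ (-(1 / 3 : ℝ)))) :=
    mul_le_mul_of_nonneg_left hmain hX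
  linarith

/-- The upper bound of Iwaniec's Theorem 1 provides greatest `β`-sieve data, so it implies
`exists_isGreatestBetaSieveData` (twin of `Iwaniec1980_thm1_lower.exists_isGreatestBetaSieveData`).
[folklore] -/
theorem Iwaniec1980_thm1_upper.exists_isGreatestBetaSieveData (h : Iwaniec1980_thm1_upper) :
    exists_isGreatestBetaSieveData :=
  fun hκ => let ⟨B, hB, _⟩ := h hκ; ⟨B, hB⟩

/-- Both main-term estimates together give both halves of Iwaniec's Theorem 1 and hence the
level-of-distribution corollaries `SieveSequence.Iwaniec1980_lower` / `Iwaniec1980_upper` of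
`SieveFunctions.lean`. [folklore] -/
theorem SieveSequence.Iwaniec1980_lower_of_mainTerm (h : Iwaniec1980_mainTerm_lower) :
    SieveSequence.Iwaniec1980_lower :=
  SieveSequence.Iwaniec1980_lower_of_thm1 (Iwaniec1980_thm1_lower_of_mainTerm h)

/-- See `SieveSequence.Iwaniec1980_lower_of_mainTerm`. [folklore] -/
theorem SieveSequence.Iwaniec1980_upper_of_mainTerm (h : Iwaniec1980_mainTerm_upper) :
    SieveSequence.Iwaniec1980_upper :=
  SieveSequence.Iwaniec1980_upper_of_thm1 (Iwaniec1980_thm1_upper_of_mainTerm h)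

end Literature.NumberTheory.Sieve
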